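import Mathlib.Combinatorics.SimpleGraph.Connectivity.Connected
import Mathlib.GroupTheory.Index
import Mathlib.GroupTheory.QuotientGroup.Defs
import Literature.InformationTheory.QuantumCodes.TannerGraph
import Literature.InformationTheory.QuantumCodes.TwoBlockCodeEquivalences
import HarnessLib

/-!
# Connectivity of the Tanner graph of a two-block (bivariate-bicycle) code — Bravyi et al. Lemma 3

Bravyi–Cross–Gambetta–Maslov–Rall–Yoder [BravyiEtAl2024, §5 Lemma 3]: "The Tanner graph of the code
`QC(A,B)` is connected if and only if `S = {A_iA_jᵀ : i,j ∈ {1,2,3}} ∪ {B_iB_jᵀ : i,j ∈ {1,2,3}}`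
generates the group `M`. The number of connected components in the Tanner graph is `ℓm/|⟨S⟩|`, and
all components are graph isomorphic to one another."  ("The definition of code `QC(A,B)` does not
guarantee that its Tanner graph is connected. Some choices of `A` and `B` lead to a code that is
actually several separable code blocks.")

For a monomial matrix `A_i = x^{α}y^{β}` the product `A_iA_jᵀ = A_iA_j⁻¹` is the DIFFERENCE of the two
exponents in `M = ℤ_ℓ × ℤ_m`; so, in the tree's additive presentation of abelian two-block codes
(`AbelianTwoBlock.css a b : CSSCode G G (G ⊕ G)`, `H_X = [A|B]`, `H_Z = [Bᵀ|Aᵀ]`, `A = circulant a`,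
`B = circulant b`, coefficient vectors `a b : G → 𝔽₂` over ANY finite abelian group `G`;
`AbelianTwoBlockCodes.lean`, `AbelianTwoBlockParameters.lean`; the BB code `QC(A,B)` is the case
`G = ℤ_ℓ × ℤ_m`, `BB.Code.css_eq`), `⟨S⟩` is

  `diffSubgroup a b = AddSubgroup.closure ((supp a − supp a) ∪ (supp b − supp b))`.

PROVED here, for every finite abelian `G` and all `a ≠ 0`, `b ≠ 0` (the printed `A`, `B` have three
terms each; for `a = 0` the statement is false — the `X`-checks then only meet `R`-qubits):

* the Tanner graph of `css a b` (vertices `X`-checks `vX i`, `Z`-checks `vZ i`, left qubits `vL j`,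
  right qubits `vR j`; `X i — L j ↔ a (i − j) ≠ 0`, `X i — R j ↔ b (i − j) ≠ 0`,
  `Z i — L j ↔ b (j − i) ≠ 0`, `Z i — R j ↔ a (j − i) ≠ 0`) and its TRANSLATION AUTOMORPHISMS
  `tannerTranslateIso g` (every label `+ g`);
* the coset LABEL `label s₀ t₀ : V → G` (`s₀ ∈ supp a`, `t₀ ∈ supp b` base points) with
  **`reachable_iff`: `x ~ y` are in one component iff `label x − label y ∈ diffSubgroup a b`** — "nodes
  in connected components of the Tanner graph are labeled by elements of the cosets of this subgroup";
* **Lemma 3 (i)** `tannerGraph_connected_iff : Connected ↔ diffSubgroup a b = ⊤`;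
* **Lemma 3 (ii)** `componentEquivQuotient : ConnectedComponent ≃ G ⧸ diffSubgroup a b`, hence
  `card_connectedComponent_eq_index` (`#components = [G : ⟨S⟩]`) and the printed form
  `card_connectedComponent_mul_card` (`#components · |⟨S⟩| = |G| = ℓm`);
* **Lemma 3 (iii)** `nonempty_iso_of_connectedComponent`: any two components are isomorphic graphs
  (a translation automorphism carries one onto the other).

The consequence for PARAMETERS (a disconnected two-block code is `[G:⟨S⟩]` disjoint copies of the
CONNECTED two-block code over `⟨S⟩`) is `TwoBlockConnectedComponents.lean`, composing this file with
the equivalences (s1) `TwoBlockCodeEquivalences.lean` and the coset decomposition (s4)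
`TwoBlockCosetDecomposition.lean`; the bivariate-bicycle phrasing and the five codes of
[BravyiEtAl2024, Table 3] are instantiated there / Summits-side.

## References (locators read on the page)
* [BravyiEtAl2024] S. Bravyi, A. W. Cross, J. M. Gambetta, D. Maslov, P. Rall, T. J. Yoder,
  *High-threshold and low-overhead fault-tolerant quantum memory*, Nature 627 (2024) 778–782 =
  arXiv:2308.07915: §5 "code connectivity" paragraph and Lemma 3 with proof (held text
  paper:arxiv-2308.07915 chunk p0011 L7–19); labels `q(T, α)`, `T ∈ {L,R,X,Z}` (p0010 L47).

No named facts; no instances; Mathlib's `SimpleGraph.Connected/ConnectedComponent`,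
`AddSubgroup.closure/index`, `QuotientAddGroup` are used as is (`lean search` 2026-08-27: no prior
formalisation of Tanner-graph connectivity in the tree or Mathlib).
-/

namespace Literature.InformationTheory.QuantumCodes

namespace AbelianTwoBlock

open Matrix SimpleGraph

variable {G : Type*} [AddCommGroup G]

/-! ### Vertices, translations, the subgroup `⟨S⟩`, coset labels (no finiteness needed) -/

/-- The `X`-check vertex `q(X, i)`. [cite: BravyiEtAl2024, §5 (labels q(T,α), T ∈ {L,R,X,Z}; arXiv:2308.07915 chunk p0010 L47)] -/
abbrev vX (i : G) : (G ⊕ G) ⊕ (G ⊕ G) := Sum.inl (Sum.inl i)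

/-- The `Z`-check vertex `q(Z, i)`. [cite: BravyiEtAl2024, §5 (arXiv:2308.07915 chunk p0010 L47)] -/
abbrev vZ (i : G) : (G ⊕ G) ⊕ (G ⊕ G) := Sum.inl (Sum.inr i)

/-- The left-block data-qubit vertex `q(L, j)`. [cite: BravyiEtAl2024, §5 (arXiv:2308.07915 chunk p0010 L47)] -/
abbrev vL (j : G) : (G ⊕ G) ⊕ (G ⊕ G) := Sum.inr (Sum.inl j)

/-- The right-block data-qubit vertex `q(R, j)`. [cite: BravyiEtAl2024, §5 (arXiv:2308.07915 chunk p0010 L47)] -/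
abbrev vR (j : G) : (G ⊕ G) ⊕ (G ⊕ G) := Sum.inr (Sum.inr j)

/-- Translation of every vertex label by `g`: `q(T, α) ↦ q(T, α + g)` for all four types `T`.
[cite: BravyiEtAl2024, §9.2 "shifts … generate" automorphisms of the Tanner graph (arXiv:2308.07915 chunk p0022 L10)] -/
def tannerTranslate (g : G) : (G ⊕ G) ⊕ (G ⊕ G) ≃ (G ⊕ G) ⊕ (G ⊕ G) :=
  Equiv.sumCongr (Equiv.sumCongr (Equiv.addRight g) (Equiv.addRight g))
    (Equiv.sumCongr (Equiv.addRight g) (Equiv.addRight g))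

/-- `X i ↦ X (i + g)`. [cite: BravyiEtAl2024, §9.2 (arXiv:2308.07915 chunk p0022 L10)] -/
@[simp] theorem tannerTranslate_vX (g i : G) : tannerTranslate g (vX i) = vX (i + g) := rfl

/-- `Z i ↦ Z (i + g)`. [cite: BravyiEtAl2024, §9.2 (arXiv:2308.07915 chunk p0022 L10)] -/
@[simp] theorem tannerTranslate_vZ (g i : G) : tannerTranslate g (vZ i) = vZ (i + g) := rfl

/-- `L j ↦ L (j + g)`. [cite: BravyiEtAl2024, §9.2 (arXiv:2308.07915 chunk p0022 L10)] -/
@[simp] theorem tannerTranslate_vL (g j : G) : tannerTranslate g (vL j) = vL (j + g) := rfl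

/-- `R j ↦ R (j + g)`. [cite: BravyiEtAl2024, §9.2 (arXiv:2308.07915 chunk p0022 L10)] -/
@[simp] theorem tannerTranslate_vR (g j : G) : tannerTranslate g (vR j) = vR (j + g) := rfl

/-- The printed generating set `S = {A_iA_jᵀ} ∪ {B_iB_jᵀ}` in additive notation: all differences
`s − s'` of two elements of `supp a`, and all differences `t − t'` of two elements of `supp b`.
[cite: BravyiEtAl2024, Lemma 3 "S = {A_iA_j^T : i,j} ∪ {B_iB_j^T : i,j}" (arXiv:2308.07915 chunk p0011 L10)] -/
def diffSet (a b : G → ZMod 2) : Set G :=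
  {d | ∃ s s', a s ≠ 0 ∧ a s' ≠ 0 ∧ d = s - s'} ∪ {d | ∃ t t', b t ≠ 0 ∧ b t' ≠ 0 ∧ d = t - t'}

/-- `⟨S⟩`, the subgroup of `G` generated by the support differences.
[cite: BravyiEtAl2024, Lemma 3 "generates the group M" / "generates a subgroup ⟨S⟩" (arXiv:2308.07915 chunk p0011 L10, L18)] -/
def diffSubgroup (a b : G → ZMod 2) : AddSubgroup G := AddSubgroup.closure (diffSet a b)

/-- `s − s' ∈ ⟨S⟩` for `s, s' ∈ supp a`. [cite: BravyiEtAl2024, Lemma 3 (arXiv:2308.07915 chunk p0011 L10)] -/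
theorem sub_mem_diffSubgroup_left {a b : G → ZMod 2} {s s' : G} (hs : a s ≠ 0) (hs' : a s' ≠ 0) :
    s - s' ∈ diffSubgroup a b :=
  AddSubgroup.subset_closure (Or.inl ⟨s, s', hs, hs', rfl⟩)

/-- `t − t' ∈ ⟨S⟩` for `t, t' ∈ supp b`. [cite: BravyiEtAl2024, Lemma 3 (arXiv:2308.07915 chunk p0011 L10)] -/
theorem sub_mem_diffSubgroup_right {a b : G → ZMod 2} {t t' : G} (ht : b t ≠ 0) (ht' : b t' ≠ 0) :
    t - t' ∈ diffSubgroup a b :=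
  AddSubgroup.subset_closure (Or.inr ⟨t, t', ht, ht', rfl⟩)

/-- The coset label of a vertex relative to base points `s₀ ∈ supp a`, `t₀ ∈ supp b`:
`L j ↦ j`, `X i ↦ i − s₀`, `Z i ↦ i + t₀`, `R j ↦ j + t₀ − s₀`. It is constant modulo `⟨S⟩` along
every edge (`label_sub_label_mem_of_adj`).
[cite: BravyiEtAl2024, proof of Lemma 3 "nodes in connected components of the Tanner graph are labeled by elements of the cosets of this subgroup" (arXiv:2308.07915 chunk p0011 L18)] -/
def label (s₀ t₀ : G) : (G ⊕ G) ⊕ (G ⊕ G) → G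
  | Sum.inl (Sum.inl i) => i - s₀
  | Sum.inl (Sum.inr i) => i + t₀
  | Sum.inr (Sum.inl j) => j
  | Sum.inr (Sum.inr j) => j + t₀ - s₀

/-- `label (X i) = i − s₀`. [cite: BravyiEtAl2024, proof of Lemma 3 (arXiv:2308.07915 chunk p0011 L18)] -/
@[simp] theorem label_vX (s₀ t₀ i : G) : label s₀ t₀ (vX i) = i - s₀ := rfl

/-- `label (Z i) = i + t₀`. [cite: BravyiEtAl2024, proof of Lemma 3 (arXiv:2308.07915 chunk p0011 L18)] -/
@[simp] theorem label_vZ (s₀ t₀ i : G) : label s₀ t₀ (vZ i) = i + t₀ := rfl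

/-- `label (L j) = j`. [cite: BravyiEtAl2024, proof of Lemma 3 (arXiv:2308.07915 chunk p0011 L18)] -/
@[simp] theorem label_vL (s₀ t₀ j : G) : label s₀ t₀ (vL j) = j := rfl

/-- `label (R j) = j + t₀ − s₀`. [cite: BravyiEtAl2024, proof of Lemma 3 (arXiv:2308.07915 chunk p0011 L18)] -/
@[simp] theorem label_vR (s₀ t₀ j : G) : label s₀ t₀ (vR j) = j + t₀ - s₀ := rfl

variable [Fintype G]

/-! ### Adjacency of the two-block Tanner graph -/

/-- `X i — L j ↔ a (i − j) ≠ 0` (entry `A i j` of `H_X = [A|B]`).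
[cite: BravyiEtAl2024, §5 "L data qubit α is part of X checks A_iᵀα" (arXiv:2308.07915 chunk p0010 L47)] -/
@[simp] theorem adj_vX_vL (a b : G → ZMod 2) (i j : G) :
    (css a b).tannerGraph.Adj (vX i) (vL j) ↔ a (i - j) ≠ 0 := by
  simp [vX, vL]

/-- `X i — R j ↔ b (i − j) ≠ 0` (entry `B i j` of `H_X = [A|B]`).
[cite: BravyiEtAl2024, §5 "R data qubit β is part of X checks B_iᵀβ" (arXiv:2308.07915 chunk p0010 L47)] -/
@[simp] theorem adj_vX_vR (a b : G → ZMod 2) (i j : G) :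
    (css a b).tannerGraph.Adj (vX i) (vR j) ↔ b (i - j) ≠ 0 := by
  simp [vX, vR]

/-- `Z i — L j ↔ b (j − i) ≠ 0` (entry `Bᵀ i j` of `H_Z = [Bᵀ|Aᵀ]`).
[cite: BravyiEtAl2024, §5 "L data qubit α is part of … Z checks B_iα" (arXiv:2308.07915 chunk p0010 L47)] -/
@[simp] theorem adj_vZ_vL (a b : G → ZMod 2) (i j : G) :
    (css a b).tannerGraph.Adj (vZ i) (vL j) ↔ b (j - i) ≠ 0 := by
  simp [vZ, vL]

/-- `Z i — R j ↔ a (j − i) ≠ 0` (entry `Aᵀ i j` of `H_Z = [Bᵀ|Aᵀ]`).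
[cite: BravyiEtAl2024, §5 "R data qubit β is part of … Z checks A_iβ" (arXiv:2308.07915 chunk p0010 L47)] -/
@[simp] theorem adj_vZ_vR (a b : G → ZMod 2) (i j : G) :
    (css a b).tannerGraph.Adj (vZ i) (vR j) ↔ a (j - i) ≠ 0 := by
  simp [vZ, vR]

/-- Symmetric form of `adj_vX_vL`. [cite: BravyiEtAl2024, §5 (arXiv:2308.07915 chunk p0010 L47)] -/
@[simp] theorem adj_vL_vX (a b : G → ZMod 2) (j i : G) :
    (css a b).tannerGraph.Adj (vL j) (vX i) ↔ a (i - j) ≠ 0 := by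
  rw [SimpleGraph.adj_comm, adj_vX_vL]

/-- Symmetric form of `adj_vX_vR`. [cite: BravyiEtAl2024, §5 (arXiv:2308.07915 chunk p0010 L47)] -/
@[simp] theorem adj_vR_vX (a b : G → ZMod 2) (j i : G) :
    (css a b).tannerGraph.Adj (vR j) (vX i) ↔ b (i - j) ≠ 0 := by
  rw [SimpleGraph.adj_comm, adj_vX_vR]

/-- Symmetric form of `adj_vZ_vL`. [cite: BravyiEtAl2024, §5 (arXiv:2308.07915 chunk p0010 L47)] -/
@[simp] theorem adj_vL_vZ (a b : G → ZMod 2) (j i : G) :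
    (css a b).tannerGraph.Adj (vL j) (vZ i) ↔ b (j - i) ≠ 0 := by
  rw [SimpleGraph.adj_comm, adj_vZ_vL]

/-- Symmetric form of `adj_vZ_vR`. [cite: BravyiEtAl2024, §5 (arXiv:2308.07915 chunk p0010 L47)] -/
@[simp] theorem adj_vR_vZ (a b : G → ZMod 2) (j i : G) :
    (css a b).tannerGraph.Adj (vR j) (vZ i) ↔ a (j - i) ≠ 0 := by
  rw [SimpleGraph.adj_comm, adj_vZ_vR]

/-- **Translations are automorphisms of the Tanner graph** of every abelian two-block code (all
adjacencies depend on label differences only).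
[cite: BravyiEtAl2024, §9.2 (translation automorphisms; arXiv:2308.07915 chunk p0022 L10)] -/
def tannerTranslateIso (a b : G → ZMod 2) (g : G) : (css a b).tannerGraph ≃g (css a b).tannerGraph where
  toEquiv := tannerTranslate g
  map_rel_iff' := by
    rintro ((i | i) | (j | j)) ((i' | i') | (j' | j')) <;> simp

section Diff

variable {a b : G → ZMod 2} {s₀ t₀ : G} (hs₀ : a s₀ ≠ 0) (ht₀ : b t₀ ≠ 0)
include hs₀ ht₀

/-- Along an edge the coset label is constant modulo `⟨S⟩`.
[cite: BravyiEtAl2024, proof of Lemma 3 (arXiv:2308.07915 chunk p0011 L13–18)] -/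
theorem label_sub_label_mem_of_adj {x y : (G ⊕ G) ⊕ (G ⊕ G)} (h : (css a b).tannerGraph.Adj x y) :
    label s₀ t₀ x - label s₀ t₀ y ∈ diffSubgroup a b := by
  suffices key : ∀ (c : G ⊕ G) (q : G ⊕ G), (css a b).tannerGraph.Adj (Sum.inl c) (Sum.inr q) →
      label s₀ t₀ (Sum.inl c) - label s₀ t₀ (Sum.inr q) ∈ diffSubgroup a b by
    rcases x with c | q <;> rcases y with c' | q'
    · exact absurd h (CSSCode.not_adj_check_check _ _ _)
    · exact key c q' h
    · rw [← neg_sub]; exact neg_mem (key c' q h.symm)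
    · exact absurd h (CSSCode.not_adj_qubit_qubit _ _ _)
  rintro (i | i) (j | j) h
  · have e : label s₀ t₀ (vX i) - label s₀ t₀ (vL j) = (i - j) - s₀ := by
      simp only [label_vX, label_vL]; abel
    exact e ▸ sub_mem_diffSubgroup_left ((adj_vX_vL a b i j).1 h) hs₀
  · have e : label s₀ t₀ (vX i) - label s₀ t₀ (vR j) = (i - j) - t₀ := by
      simp only [label_vX, label_vR]; abel
    exact e ▸ sub_mem_diffSubgroup_right ((adj_vX_vR a b i j).1 h) ht₀
  · have e : label s₀ t₀ (vZ i) - label s₀ t₀ (vL j) = t₀ - (j - i) := by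
      simp only [label_vZ, label_vL]; abel
    exact e ▸ sub_mem_diffSubgroup_right ht₀ ((adj_vZ_vL a b i j).1 h)
  · have e : label s₀ t₀ (vZ i) - label s₀ t₀ (vR j) = s₀ - (j - i) := by
      simp only [label_vZ, label_vR]; abel
    exact e ▸ sub_mem_diffSubgroup_left hs₀ ((adj_vZ_vR a b i j).1 h)

/-- Along a walk the coset label is constant modulo `⟨S⟩`: reachable vertices have labels in one coset.
[cite: BravyiEtAl2024, proof of Lemma 3 "the path from a type T node to any other T node is necessarily described as a product of elements from S" (arXiv:2308.07915 chunk p0011 L16)] -/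
theorem label_sub_label_mem_of_reachable {x y : (G ⊕ G) ⊕ (G ⊕ G)}
    (h : (css a b).tannerGraph.Reachable x y) :
    label s₀ t₀ x - label s₀ t₀ y ∈ diffSubgroup a b := by
  obtain ⟨p⟩ := h
  induction p with
  | nil => simp
  | cons hadj _ ih =>
    have := add_mem (label_sub_label_mem_of_adj hs₀ ht₀ hadj) ih
    rwa [sub_add_sub_cancel] at this

omit hs₀ ht₀ in
/-- The reverse implication's engine: `L g` and `L (g + h)` are joined for every `h ∈ ⟨S⟩` — length-2
paths `L α → X → L (A_iA_jᵀ α)` and `L α → Z → L (B_iB_jᵀ α)`, closed under composition and reversal.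
[cite: BravyiEtAl2024, proof of Lemma 3 "there is a length 2 path in the Tanner graph from L qubit α to L qubit A_iA_j^Tα and another length 2 path to L qubit B_iB_j^Tα" (arXiv:2308.07915 chunk p0011 L13–14)] -/
theorem reachable_vL_add_of_mem {h : G} (hh : h ∈ diffSubgroup a b) (g : G) :
    (css a b).tannerGraph.Reachable (vL g) (vL (g + h)) := by
  induction hh using AddSubgroup.closure_induction generalizing g with
  | mem d hd =>
    rcases hd with ⟨s, s', hs, hs', rfl⟩ | ⟨t, t', ht, ht', rfl⟩
    · have h1 : (css a b).tannerGraph.Adj (vL g) (vX (g + s)) := by simp [hs]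
      have h2 : (css a b).tannerGraph.Adj (vX (g + s)) (vL (g + (s - s'))) := by
        rw [adj_vX_vL]; convert hs' using 2; abel
      exact h1.reachable.trans h2.reachable
    · have h1 : (css a b).tannerGraph.Adj (vL g) (vZ (g - t')) := by simp [ht']
      have h2 : (css a b).tannerGraph.Adj (vZ (g - t')) (vL (g + (t - t'))) := by
        rw [adj_vZ_vL]; convert ht using 2; abel
      exact h1.reachable.trans h2.reachable
  | zero => rw [add_zero]
  | add x y _ _ ihx ihy => rw [← add_assoc]; exact (ihx g).trans (ihy (g + x))
  | neg x _ ih => simpa using (ih (g + -x)).symm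

/-- Every vertex is joined to the `L`-qubit carrying its label ("each `X` check and each `Z` check are
connected to at least one `L` qubit and at least one `R` qubit").
[cite: BravyiEtAl2024, proof of Lemma 3 (arXiv:2308.07915 chunk p0011 L15)] -/
theorem reachable_vL_label (x : (G ⊕ G) ⊕ (G ⊕ G)) :
    (css a b).tannerGraph.Reachable x (vL (label s₀ t₀ x)) := by
  rcases x with (i | i) | (j | j)
  · exact Adj.reachable (by simpa using hs₀)
  · exact Adj.reachable (by simpa using ht₀)
  · exact Reachable.refl _
  · have h1 : (css a b).tannerGraph.Adj (vR j) (vX (j + t₀)) := by simpa using ht₀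
    have h2 : (css a b).tannerGraph.Adj (vX (j + t₀)) (vL (j + t₀ - s₀)) := by simpa using hs₀
    exact h1.reachable.trans h2.reachable

/-- **Components = cosets**: two vertices lie in one connected component iff their labels agree modulo
`⟨S⟩`. [cite: BravyiEtAl2024, proof of Lemma 3 "nodes in connected components of the Tanner graph are labeled by elements of the cosets of this subgroup" (arXiv:2308.07915 chunk p0011 L18)] -/
theorem reachable_iff (x y : (G ⊕ G) ⊕ (G ⊕ G)) :
    (css a b).tannerGraph.Reachable x y ↔ label s₀ t₀ x - label s₀ t₀ y ∈ diffSubgroup a b := by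
  refine ⟨label_sub_label_mem_of_reachable hs₀ ht₀, fun h => ?_⟩
  have hy := reachable_vL_add_of_mem h (label s₀ t₀ y)
  rw [add_sub_cancel] at hy
  exact ((reachable_vL_label hs₀ ht₀ x).trans hy.symm).trans (reachable_vL_label hs₀ ht₀ y).symm

/-! ### Lemma 3 -/

/-- **Lemma 3 (ii), bijection form**: the connected components of the Tanner graph are in bijection with
the cosets `G ⧸ ⟨S⟩`, via the coset label. [cite: BravyiEtAl2024, Lemma 3 and proof "labeled by elements of the cosets of this subgroup" (arXiv:2308.07915 chunk p0011 L10–18)] -/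
noncomputable def componentEquivQuotient :
    (css a b).tannerGraph.ConnectedComponent ≃ G ⧸ diffSubgroup a b :=
  Equiv.ofBijective
    (ConnectedComponent.lift (fun x => (QuotientAddGroup.mk (label s₀ t₀ x) : G ⧸ diffSubgroup a b))
      (fun _ _ p _ => QuotientAddGroup.eq_iff_sub_mem.mpr
        (label_sub_label_mem_of_reachable hs₀ ht₀ p.reachable)))
    (by
      constructor
      · refine ConnectedComponent.ind₂ fun x y hxy => ?_
        replace hxy : (QuotientAddGroup.mk (label s₀ t₀ x) : G ⧸ diffSubgroup a b) =
            QuotientAddGroup.mk (label s₀ t₀ y) := hxy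
        exact ConnectedComponent.sound ((reachable_iff hs₀ ht₀ x y).mpr
          (QuotientAddGroup.eq_iff_sub_mem.mp hxy))
      · rintro ⟨g⟩
        exact ⟨(css a b).tannerGraph.connectedComponentMk (vL g), rfl⟩)

end Diff

variable {a b : G → ZMod 2}

/-- **Lemma 3 (i)**: for `a ≠ 0`, `b ≠ 0` the Tanner graph of the two-block code is connected iff the
support differences generate the whole group: `⟨S⟩ = G`.
[cite: BravyiEtAl2024, Lemma 3 "The Tanner graph of the code QC(A,B) is connected if and only if S … generates the group M" (arXiv:2308.07915 chunk p0011 L9–10)] -/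
theorem tannerGraph_connected_iff (ha : a ≠ 0) (hb : b ≠ 0) :
    (css a b).tannerGraph.Connected ↔ diffSubgroup a b = ⊤ := by
  obtain ⟨s₀, hs₀⟩ : ∃ s, a s ≠ 0 := Function.ne_iff.mp ha
  obtain ⟨t₀, ht₀⟩ : ∃ t, b t ≠ 0 := Function.ne_iff.mp hb
  rw [connected_iff_exists_forall_reachable, AddSubgroup.eq_top_iff']
  constructor
  · rintro ⟨v, hv⟩ g
    have h := (reachable_iff hs₀ ht₀ _ _).mp ((hv (vL g)).symm.trans (hv (vL 0)))
    simpa using h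
  · intro h
    exact ⟨vL 0, fun w => (reachable_iff hs₀ ht₀ _ _).mpr (h _)⟩

/-- **Lemma 3 (ii)**: the number of connected components is the index `[G : ⟨S⟩]`.
[cite: BravyiEtAl2024, Lemma 3 "The number of connected components in the Tanner graph is ℓm/|⟨S⟩|" (arXiv:2308.07915 chunk p0011 L10)] -/
theorem card_connectedComponent_eq_index (ha : a ≠ 0) (hb : b ≠ 0) :
    Nat.card (css a b).tannerGraph.ConnectedComponent = (diffSubgroup a b).index := by
  obtain ⟨s₀, hs₀⟩ : ∃ s, a s ≠ 0 := Function.ne_iff.mp ha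
  obtain ⟨t₀, ht₀⟩ : ∃ t, b t ≠ 0 := Function.ne_iff.mp hb
  exact Nat.card_congr (componentEquivQuotient hs₀ ht₀)

/-- **Lemma 3 (ii), printed form** `#components · |⟨S⟩| = |G|` (`= ℓm` for `G = ℤ_ℓ × ℤ_m`), i.e.
`#components = ℓm/|⟨S⟩|`. [cite: BravyiEtAl2024, Lemma 3 "ℓm/|⟨S⟩|" (arXiv:2308.07915 chunk p0011 L10)] -/
theorem card_connectedComponent_mul_card (ha : a ≠ 0) (hb : b ≠ 0) :
    Nat.card (css a b).tannerGraph.ConnectedComponent * Nat.card (diffSubgroup a b) = Nat.card G := by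
  rw [card_connectedComponent_eq_index ha hb, AddSubgroup.index_mul_card]

/-- **Lemma 3 (ii), division form** `#components = |G| / |⟨S⟩|`.
[cite: BravyiEtAl2024, Lemma 3 "The number of connected components in the Tanner graph is ℓm/|⟨S⟩|" (arXiv:2308.07915 chunk p0011 L10)] -/
theorem card_connectedComponent_eq_div (ha : a ≠ 0) (hb : b ≠ 0) :
    Nat.card (css a b).tannerGraph.ConnectedComponent = Nat.card G / Nat.card (diffSubgroup a b) := by
  rw [← card_connectedComponent_mul_card ha hb,
    Nat.mul_div_cancel _ (Nat.card_pos (α := diffSubgroup a b))]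

omit [Fintype G] in
/-- A graph isomorphism restricts to an isomorphism between a connected component and its image
component. [folklore] -/
def componentIsoOfIso {V W : Type*} {Γ : SimpleGraph V} {Γ' : SimpleGraph W} (φ : Γ ≃g Γ')
    (C : Γ.ConnectedComponent) :
    C.toSimpleGraph ≃g (φ.connectedComponentEquiv C).toSimpleGraph where
  toEquiv := ConnectedComponent.isoEquivSupp φ C
  map_rel_iff' := φ.map_rel_iff'

/-- Every connected component contains an `L`-qubit. [cite: BravyiEtAl2024, proof of Lemma 3 (arXiv:2308.07915 chunk p0011 L15)] -/
theorem exists_vL_mem (ha : a ≠ 0) (hb : b ≠ 0) (C : (css a b).tannerGraph.ConnectedComponent) :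
    ∃ g : G, (css a b).tannerGraph.connectedComponentMk (vL g) = C := by
  obtain ⟨s₀, hs₀⟩ : ∃ s, a s ≠ 0 := Function.ne_iff.mp ha
  obtain ⟨t₀, ht₀⟩ : ∃ t, b t ≠ 0 := Function.ne_iff.mp hb
  induction C using ConnectedComponent.ind with
  | h x => exact ⟨label s₀ t₀ x, (ConnectedComponent.sound (reachable_vL_label hs₀ ht₀ x)).symm⟩

/-- **Lemma 3 (iii)**: all connected components of the Tanner graph are isomorphic graphs (the
translation by `g₂ − g₁` carries the component of `L g₁` onto the component of `L g₂`).
[cite: BravyiEtAl2024, Lemma 3 "all components are graph isomorphic to one another" (arXiv:2308.07915 chunk p0011 L10)] -/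
theorem nonempty_iso_of_connectedComponent (ha : a ≠ 0) (hb : b ≠ 0)
    (C D : (css a b).tannerGraph.ConnectedComponent) :
    Nonempty (C.toSimpleGraph ≃g D.toSimpleGraph) := by
  obtain ⟨g₁, rfl⟩ := exists_vL_mem ha hb C
  obtain ⟨g₂, rfl⟩ := exists_vL_mem ha hb D
  let φ := tannerTranslateIso a b (g₂ - g₁)
  have hφ : φ.connectedComponentEquiv ((css a b).tannerGraph.connectedComponentMk (vL g₁)) =
      (css a b).tannerGraph.connectedComponentMk (vL g₂) := by
    rw [Iso.connectedComponentEquiv_apply, ConnectedComponent.map_mk]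
    change (css a b).tannerGraph.connectedComponentMk (tannerTranslate (g₂ - g₁) (vL g₁)) = _
    rw [tannerTranslate_vL, add_sub_cancel]
  exact ⟨(componentIsoOfIso φ _).trans (hφ ▸ Iso.refl)⟩

end AbelianTwoBlock

end Literature.InformationTheory.QuantumCodes
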